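import Summits.KontsevichZagierPeriods.Zeta5Search.TwoTaleP15Slice
import Summits.KontsevichZagierPeriods.Zeta5Search.Denom.TwoTaleD1SliceLemmas

/-!
# RUNG D1 = L(1/3): the SLICE LEMMA — `p̂_n ∈ ℤ_p` for every prime `p > 25n` (file F8 of the D1 note)

HONEST FRAMING: systematic search; no irrationality claim unless certified.

Cell pub-zeta5 (P1 g12 draft of F8 of fam-denom's `families/denom/D1-DESIGN-NOTE.md`, 'fam-denom (or P1)'; design =
the P15 slice law of fam-denom g7 / P1 g10, tree file `TwoTaleP15Slice`, moved from `17n` to `25n`).  Denominator side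
only; nothing about irrationality.  At the Remark-5 partner `(aTD1 n, bTD1 n) = (47n+2; 16n+1, 19n+1, 22n+1 | 22n+2; 9n+1,
35n+2, 38n+2)` of D1:

* **`padicNorm_formPT_le_one_of_gt : 1 ≤ n → 25n < p → ‖formPT (aTD1 n) (bTD1 n)‖_p ≤ 1`.**

Proof (termwise slice law, verbatim the P15 argument with every side condition linear).  `p̂_n = ± Σ_k (2A_k S₂(m_k)
+ B_k S₁(m_k))`, `m_k = 2k − 38n − 2 ≤ 38n < 2p`, `A_k, B_k ∈ ℤ_p` for `p > 25n` (`TwoTaleD1SliceLemmas`, via the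
generic `SecondTaleLargePrime`), so the `k`-th term is `≡ (2A_k + pB_k)/p²`, and by the partial fractions of `R̂`
(`RT_eq_polar`) at `t_k = p/2 − k` (all `t_k + j`, `j ≠ k`, are `p`-units since `|j − k| ≤ 19n < p`)
`(2A_k + pB_k)/p² ≡ ½R̂(t_k)`; `R̂(t_k) = 0` for `22n+2 ≤ 2k − p ≤ 47n+1` (a zero of the doubled numerator block), while
for `2k − p ≥ 47n+2` (forcing `p ≤ 29n`, `k ≥ 35n+2`, a simple pole) the numerator factor `t_k + (k−p) = −p/2`
(`9n+1 ≤ k − p ≤ 16n`) pays for the single denominator factor `t_k + k = p/2`.  The half-integer-point lemmas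
(`tk_add_eq`, `padicNorm_tk_*`, `padicNorm_prod_tk_eq_one/inv`, `padicNorm_two_tk_add_le_one`) and the harmonic slices
(`padicNorm_harmAlt{1,2}_le_one`, `padicNorm_harmAlt{1,2}_sub_le`) are the tree's `TwoTaleP15` lemmas, used by name.
-/

noncomputable section

namespace Summit.KontsevichZagierPeriods.Zeta5Search.Denom.TwoTaleD1Slice

open Finset Polynomial
open Literature.NumberTheory.Irrationality.Zudilin2014
open Summit.KontsevichZagierPeriods.Zeta5Search.Denom.TwoTaleD1Forms (aTD1 bTD1 aTD1_zero aTD1_one aTD1_two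
  aTD1_three bTD1_zero bTD1_one bTD1_two bTD1_three)
open Summit.KontsevichZagierPeriods.Zeta5Search.TwoTaleWhippleD1 (admissibleTD1 rangeD1_eq)
open Summit.KontsevichZagierPeriods.Zeta5Search.TwoTaleP15 (tk_add_eq tk_add_ne_zero padicNorm_tk_add_le_one
  padicNorm_tk_add_eq_one padicNorm_tk_self padicNorm_two_tk_add_le_one padicNorm_prod_tk_eq_one
  padicNorm_prod_tk_eq_inv padicNorm_harmAlt2_le_one padicNorm_harmAlt1_le_one padicNorm_harmAlt2_sub_le
  padicNorm_harmAlt1_sub_le padicNorm_prod_le_one padicNorm_half_p)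

variable {n : ℕ} {p : ℕ} [hp : Fact p.Prime]

/-! ### `R̂(t_k)` at the half-integer point `t_k = p/2 − k` -/

/-- `denT(t_k) ≠ 0`: `t_k` is never a pole. -/
theorem eval_denT_tk_ne_zero (h2 : p ≠ 2) (k : ℤ) : (denT (aTD1 n) (bTD1 n)).eval ((p : ℚ) / 2 - k) ≠ 0 := by
  unfold denT
  rw [eval_mul]
  exact mul_ne_zero (eval_block_ne_zero fun i _ h => tk_add_ne_zero h2 k i (by rw [h]; ring))
    (eval_block_ne_zero fun i _ h => tk_add_ne_zero h2 k i (by rw [h]; ring))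

omit hp in
/-- Case A: `22n+2 ≤ 2k − p ≤ 47n+1` ⇒ the doubled numerator block vanishes at `t_k`, `R̂(t_k) = 0`. -/
theorem RT_tk_eq_zero {k : ℤ} (hlo : 22 * (n : ℤ) + 2 ≤ 2 * k - p) (hhi : 2 * k - p ≤ 47 * (n : ℤ) + 1) :
    RT (aTD1 n) (bTD1 n) ((p : ℚ) / 2 - k) = 0 := by
  unfold RT numT
  rw [eval_mul, eval_C, eval_mul, eval_block2]
  have hmem : 2 * k - p ∈ Ico (bTD1 n 0) (aTD1 n 0) := by simp [mem_Ico]; omega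
  rw [prod_eq_zero hmem (by push_cast; ring), zero_mul, mul_zero, zero_div]

/-- Case B: `2k − p ≥ 47n+2`, `k ≤ 38n+1`, `p > 25n` ⇒ `‖numT(t_k)‖_p ≤ p⁻¹` (the factor `t_k + (k−p) = −p/2`,
`9n+1 ≤ k−p ≤ 16n`). -/
theorem padicNorm_eval_numT_tk_le (hp25 : 25 * n < p) {k : ℤ} (hB : 47 * (n : ℤ) + 2 ≤ 2 * k - p)
    (hk : k ≤ 38 * (n : ℤ) + 1) :
    padicNorm p ((numT (aTD1 n) (bTD1 n)).eval ((p : ℚ) / 2 - k)) ≤ (p : ℚ)⁻¹ := by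
  have h2 : p ≠ 2 := by omega
  have hp25' : 25 * (n : ℤ) < p := by exact_mod_cast hp25
  unfold numT
  rw [eval_mul, eval_C, eval_mul, eval_block2, eval_block, padicNorm.mul, padicNorm_normT_D1 hp25, one_mul,
    padicNorm.mul]
  have hD : padicNorm p (∏ l ∈ Ico (bTD1 n 0) (aTD1 n 0), (2 * ((p : ℚ) / 2 - k) + l)) ≤ 1 :=
    padicNorm_prod_le_one fun l _ => padicNorm_two_tk_add_le_one k l
  have hmem : k - p ∈ Ico (bTD1 n 1) (aTD1 n 1) := by simp [mem_Ico]; omega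
  have hB1 : padicNorm p (∏ j ∈ Ico (bTD1 n 1) (aTD1 n 1), ((p : ℚ) / 2 - k + j)) ≤ (p : ℚ)⁻¹ := by
    rw [← mul_prod_erase _ _ hmem, padicNorm.mul]
    have e : (p : ℚ) / 2 - k + ((k - p : ℤ) : ℚ) = -((p : ℚ) / 2) := by push_cast; ring
    rw [e, padicNorm.neg, padicNorm_half_p h2]
    calc (p : ℚ)⁻¹ * padicNorm p (∏ x ∈ (Ico (bTD1 n 1) (aTD1 n 1)).erase (k - p), ((p : ℚ) / 2 - k + x))
        ≤ (p : ℚ)⁻¹ * 1 := mul_le_mul_of_nonneg_left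
          (padicNorm_prod_le_one fun j _ => padicNorm_tk_add_le_one h2 k j) (by positivity)
      _ = (p : ℚ)⁻¹ := mul_one _
  calc padicNorm p (∏ l ∈ Ico (bTD1 n 0) (aTD1 n 0), (2 * ((p : ℚ) / 2 - k) + l))
        * padicNorm p (∏ j ∈ Ico (bTD1 n 1) (aTD1 n 1), ((p : ℚ) / 2 - k + j))
      ≤ 1 * (p : ℚ)⁻¹ := mul_le_mul hD hB1 (padicNorm.nonneg _) zero_le_one
    _ = (p : ℚ)⁻¹ := one_mul _

/-- Case B: `‖R̂(t_k)‖_p ≤ 1` (the numerator `p` pays for the simple pole). -/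
theorem padicNorm_RT_tk_le_one (hp25 : 25 * n < p) {k : ℤ} (hB : 47 * (n : ℤ) + 2 ≤ 2 * k - p)
    (hk : k ≤ 38 * (n : ℤ) + 1) : padicNorm p (RT (aTD1 n) (bTD1 n) ((p : ℚ) / 2 - k)) ≤ 1 := by
  have h2 : p ≠ 2 := by omega
  have hp25' : 25 * (n : ℤ) < p := by exact_mod_cast hp25
  have hp0 : (0 : ℚ) < (p : ℚ)⁻¹ := by have := hp.out.pos; positivity
  unfold RT denT
  rw [eval_mul, eval_block, eval_block, padicNorm.div, padicNorm.mul,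
    padicNorm_prod_tk_eq_one h2 (k := k) (by simp [mem_Ico]; omega)
      (fun j hj => by simp only [mem_Ico, aTD1_two, bTD1_two] at hj; omega),
    padicNorm_prod_tk_eq_inv h2 (k := k) (by simp [mem_Ico]; omega)
      (fun j hj => by simp only [mem_Ico, aTD1_three, bTD1_three] at hj; omega),
    one_mul, div_le_iff₀ hp0, one_mul]
  exact padicNorm_eval_numT_tk_le hp25 hB hk

/-! ### The slice identity and the slice term -/

/-- **The slice identity**: the partial fractions of `R̂` at `t_k = p/2 − k` with the `k`-terms extracted,
`2(2A_k + pB_k)/p² = R̂(t_k) − Σ_{j≠k} A_j/(t_k+j)² − Σ_{j≠k} B_j/(t_k+j)`. -/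
theorem slice_identity (hn : 1 ≤ n) (h2 : p ≠ 2) {k : ℤ} (hk1 : 22 * (n : ℤ) + 1 ≤ k)
    (hk2 : k ≤ 38 * (n : ℤ) + 1) :
    2 * ((2 * coefAT (aTD1 n) (bTD1 n) k + p * coefBT (aTD1 n) (bTD1 n) k) / (p : ℚ) ^ 2)
      = RT (aTD1 n) (bTD1 n) ((p : ℚ) / 2 - k)
        - ∑ j ∈ (Ico (22 * (n : ℤ) + 1) (35 * (n : ℤ) + 2)).erase k,
            coefAT (aTD1 n) (bTD1 n) j / ((p : ℚ) / 2 - k + j) ^ 2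
        - ∑ j ∈ (Ico (19 * (n : ℤ) + 1) (38 * (n : ℤ) + 2)).erase k,
            coefBT (aTD1 n) (bTD1 n) j / ((p : ℚ) / 2 - k + j) := by
  have hp0 : (p : ℚ) ≠ 0 := by exact_mod_cast hp.out.ne_zero
  obtain ⟨hA3, hB2⟩ := rangeD1_eq n
  obtain ⟨hMid, hMax, -⟩ := rangeBD1_eq n
  have hPF := RT_eq_polar (admissibleTD1 hn) (eval_denT_tk_ne_zero (n := n) h2 k)
  rw [hA3, hB2, hMid, hMax] at hPF
  have hkB : k ∈ Ico (19 * (n : ℤ) + 1) (38 * (n : ℤ) + 2) := by simp [mem_Ico]; omega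
  have hAk : ∑ j ∈ Ico (22 * (n : ℤ) + 1) (35 * (n : ℤ) + 2), coefAT (aTD1 n) (bTD1 n) j / ((p : ℚ) / 2 - k + j) ^ 2
      = coefAT (aTD1 n) (bTD1 n) k / ((p : ℚ) / 2 - k + k) ^ 2
        + ∑ j ∈ (Ico (22 * (n : ℤ) + 1) (35 * (n : ℤ) + 2)).erase k,
            coefAT (aTD1 n) (bTD1 n) j / ((p : ℚ) / 2 - k + j) ^ 2 := by
    by_cases hkA : k ∈ Ico (22 * (n : ℤ) + 1) (35 * (n : ℤ) + 2)
    · exact (add_sum_erase _ (fun j => coefAT (aTD1 n) (bTD1 n) j / ((p : ℚ) / 2 - k + j) ^ 2) hkA).symm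
    · rw [erase_eq_of_notMem hkA]
      have hkA' : 35 * (n : ℤ) + 2 ≤ k := by simp [mem_Ico] at hkA; omega
      rw [coefAT_eq_zero_of_simple_D1 (by omega) hk2 (Or.inr hkA'), zero_div, zero_add]
  rw [← add_sum_erase _ _ hkB, hAk, sub_add_cancel] at hPF
  rw [hPF]
  field_simp
  ring

/-- **The slice term is `p`-integral**: `‖(2A_k + pB_k)/p²‖_p ≤ 1` for `p + 38n + 2 ≤ 2k ≤ 76n + 2`, `p > 25n`. -/
theorem padicNorm_sliceTerm_le_one (hn : 1 ≤ n) (hp25 : 25 * n < p) {k : ℤ}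
    (hK : (p : ℤ) + 38 * n + 2 ≤ 2 * k) (hk2 : k ≤ 38 * (n : ℤ) + 1) :
    padicNorm p ((2 * coefAT (aTD1 n) (bTD1 n) k + p * coefBT (aTD1 n) (bTD1 n) k) / (p : ℚ) ^ 2) ≤ 1 := by
  have h2 : p ≠ 2 := by omega
  have hp25' : 25 * (n : ℤ) < p := by exact_mod_cast hp25
  have h2n : padicNorm p (2 : ℚ) = 1 := by
    simpa using padicNorm.padicNorm_of_prime_of_ne (p := p) (q := 2) h2
  have key : (2 * coefAT (aTD1 n) (bTD1 n) k + p * coefBT (aTD1 n) (bTD1 n) k) / (p : ℚ) ^ 2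
      = (RT (aTD1 n) (bTD1 n) ((p : ℚ) / 2 - k)
        - ∑ j ∈ (Ico (22 * (n : ℤ) + 1) (35 * (n : ℤ) + 2)).erase k,
            coefAT (aTD1 n) (bTD1 n) j / ((p : ℚ) / 2 - k + j) ^ 2
        - ∑ j ∈ (Ico (19 * (n : ℤ) + 1) (38 * (n : ℤ) + 2)).erase k,
            coefBT (aTD1 n) (bTD1 n) j / ((p : ℚ) / 2 - k + j)) / 2 := by
    rw [← slice_identity hn h2 (by omega) hk2]; ring
  rw [key, padicNorm.div, h2n, div_one]
  have hRT : padicNorm p (RT (aTD1 n) (bTD1 n) ((p : ℚ) / 2 - k)) ≤ 1 := by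
    rcases le_or_gt (2 * k - (p : ℤ)) (47 * (n : ℤ) + 1) with hA | hB
    · rw [RT_tk_eq_zero (by omega) hA, padicNorm.zero]; exact zero_le_one
    · exact padicNorm_RT_tk_le_one hp25 (by omega) hk2
  have hrestA : padicNorm p (∑ j ∈ (Ico (22 * (n : ℤ) + 1) (35 * (n : ℤ) + 2)).erase k,
      coefAT (aTD1 n) (bTD1 n) j / ((p : ℚ) / 2 - k + j) ^ 2) ≤ 1 := by
    refine padicNorm.sum_le' (fun j hj => ?_) zero_le_one
    have hjk := ne_of_mem_erase hj
    have hj' := mem_of_mem_erase hj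
    simp only [mem_Ico] at hj'
    rw [padicNorm.div, sq, padicNorm.mul, padicNorm_tk_add_eq_one h2 hjk (by omega), mul_one, div_one]
    exact padicNorm_coefAT_le_one_D1 hn hp25 hj'.1 (by omega)
  have hrestB : padicNorm p (∑ j ∈ (Ico (19 * (n : ℤ) + 1) (38 * (n : ℤ) + 2)).erase k,
      coefBT (aTD1 n) (bTD1 n) j / ((p : ℚ) / 2 - k + j)) ≤ 1 := by
    refine padicNorm.sum_le' (fun j hj => ?_) zero_le_one
    have hjk := ne_of_mem_erase hj
    have hj' := mem_of_mem_erase hj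
    simp only [mem_Ico] at hj'
    rw [padicNorm.div, padicNorm_tk_add_eq_one h2 hjk (by omega), div_one]
    exact padicNorm_coefBT_le_one_D1 hn hp25 hj'.1 (by omega)
  exact (padicNorm.sub).trans (max_le ((padicNorm.sub).trans (max_le hRT hrestA)) hrestB)

/-! ### Assembly -/

/-- **Each term of `p̂_n` is `p`-integral** (`p > 25n`, `19n+1 ≤ k ≤ 38n+1`):
`‖2A_k S₂(m_k) + B_k S₁(m_k)‖_p ≤ 1`, `m_k = 2k − 38n − 2`. -/
theorem padicNorm_term_le_one (hn : 1 ≤ n) (hp25 : 25 * n < p) {k : ℤ} (hk1 : 19 * (n : ℤ) + 1 ≤ k)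
    (hk2 : k ≤ 38 * (n : ℤ) + 1) :
    padicNorm p (2 * coefAT (aTD1 n) (bTD1 n) k * harmAlt2 (2 * k - (38 * (n : ℤ) + 2)).toNat
      + coefBT (aTD1 n) (bTD1 n) k * harmAlt1 (2 * k - (38 * (n : ℤ) + 2)).toNat) ≤ 1 := by
  have h2 : p ≠ 2 := by omega
  have hp25' : 25 * (n : ℤ) < p := by exact_mod_cast hp25
  have hp0 : (p : ℚ) ≠ 0 := by exact_mod_cast hp.out.ne_zero
  have h2le : padicNorm p (2 : ℚ) ≤ 1 := by have := padicNorm.of_int (p := p) 2; simpa using this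
  have hA1 : padicNorm p (coefAT (aTD1 n) (bTD1 n) k) ≤ 1 := by
    rcases le_or_gt k (22 * (n : ℤ)) with h | h
    · rw [coefAT_eq_zero_of_simple_D1 hk1 hk2 (Or.inl h), padicNorm.zero]; exact zero_le_one
    rcases le_or_gt k (35 * (n : ℤ) + 1) with h' | h'
    · exact padicNorm_coefAT_le_one_D1 hn hp25 (by omega) h'
    · rw [coefAT_eq_zero_of_simple_D1 hk1 hk2 (Or.inr (by omega)), padicNorm.zero]; exact zero_le_one
  have hB1 := padicNorm_coefBT_le_one_D1 hn hp25 hk1 hk2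
  have h2A : padicNorm p (2 * coefAT (aTD1 n) (bTD1 n) k) ≤ 1 := by
    rw [padicNorm.mul]; exact mul_le_one₀ h2le (padicNorm.nonneg _) hA1
  rcases lt_or_ge (2 * k - (38 * (n : ℤ) + 2)) (p : ℤ) with hlt | hge
  · -- no `ℓ = p` term
    have hm : (2 * k - (38 * (n : ℤ) + 2)).toNat < p := by omega
    refine (padicNorm.nonarchimedean).trans (max_le ?_ ?_)
    · rw [padicNorm.mul]; exact mul_le_one₀ h2A (padicNorm.nonneg _) (padicNorm_harmAlt2_le_one hm)
    · rw [padicNorm.mul]; exact mul_le_one₀ hB1 (padicNorm.nonneg _) (padicNorm_harmAlt1_le_one hm)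
  · -- the `ℓ = p` slice
    have hpm : p ≤ (2 * k - (38 * (n : ℤ) + 2)).toNat := by omega
    have hm2 : (2 * k - (38 * (n : ℤ) + 2)).toNat < 2 * p := by omega
    have hr2 := padicNorm_harmAlt2_sub_le h2 hpm hm2
    have hr1 := padicNorm_harmAlt1_sub_le h2 hpm hm2
    have hS := padicNorm_sliceTerm_le_one hn hp25 (by omega) hk2
    have e : 2 * coefAT (aTD1 n) (bTD1 n) k * harmAlt2 (2 * k - (38 * (n : ℤ) + 2)).toNat
        + coefBT (aTD1 n) (bTD1 n) k * harmAlt1 (2 * k - (38 * (n : ℤ) + 2)).toNat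
        = (2 * coefAT (aTD1 n) (bTD1 n) k + p * coefBT (aTD1 n) (bTD1 n) k) / (p : ℚ) ^ 2
          + (2 * coefAT (aTD1 n) (bTD1 n) k * (harmAlt2 (2 * k - (38 * (n : ℤ) + 2)).toNat - 1 / (p : ℚ) ^ 2)
            + coefBT (aTD1 n) (bTD1 n) k * (harmAlt1 (2 * k - (38 * (n : ℤ) + 2)).toNat - 1 / (p : ℚ))) := by
      field_simp
      ring
    rw [e]
    refine (padicNorm.nonarchimedean).trans (max_le hS ((padicNorm.nonarchimedean).trans (max_le ?_ ?_)))
    · rw [padicNorm.mul]; exact mul_le_one₀ h2A (padicNorm.nonneg _) hr2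
    · rw [padicNorm.mul]; exact mul_le_one₀ hB1 (padicNorm.nonneg _) hr1

/-- **THE SLICE LEMMA at D1**: for every `n ≥ 1` and every prime `p > 25n`, `‖p̂_n‖_p ≤ 1`, i.e. no prime `p > 25n`
divides the denominator of `formPT (aTD1 n) (bTD1 n)`. -/
theorem padicNorm_formPT_le_one_of_gt (hn : 1 ≤ n) (hp25 : 25 * n < p) :
    padicNorm p (formPT (aTD1 n) (bTD1 n)) ≤ 1 := by
  obtain ⟨hA3, hB2⟩ := rangeD1_eq n
  obtain ⟨hMid, hMax, h0s⟩ := rangeBD1_eq n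
  have hsign : padicNorm p (signT (bTD1 n)) = 1 := by
    unfold signT; rcases neg_one_pow_eq_or ℚ (bTD1 n 2 + bTD1 n 3).natAbs with h | h <;> rw [h] <;> simp
  unfold formPT
  rw [padicNorm.mul, hsign, one_mul, hA3, hB2, hMid, hMax, h0s]
  have hsub : Ico (22 * (n : ℤ) + 1) (35 * (n : ℤ) + 2) ⊆ Ico (19 * (n : ℤ) + 1) (38 * (n : ℤ) + 2) :=
    Ico_subset_Ico (by omega) (by omega)
  have hzero : ∀ k ∈ Ico (19 * (n : ℤ) + 1) (38 * (n : ℤ) + 2), k ∉ Ico (22 * (n : ℤ) + 1) (35 * (n : ℤ) + 2) →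
      2 * coefAT (aTD1 n) (bTD1 n) k * harmAlt2 (2 * k - (38 * (n : ℤ) + 2)).toNat = 0 := by
    intro k hk hk'
    simp only [mem_Ico, not_and, not_lt] at hk hk'
    rw [coefAT_eq_zero_of_simple_D1 hk.1 (by omega) (by omega), mul_zero, zero_mul]
  rw [sum_subset hsub hzero, ← sum_add_distrib]
  refine padicNorm.sum_le' (fun k hk => ?_) zero_le_one
  rw [mem_Ico] at hk
  exact padicNorm_term_le_one hn hp25 hk.1 (by omega)

/-- Integer form: for `p > 25n` prime and any integer multiple `z = N · p̂_n` with `N ∈ ℤ`, `‖z‖_p ≤ ‖N‖_p`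
— in particular `p ∤ den(p̂_n)`. -/
theorem padicNorm_mul_formPT_le (hn : 1 ≤ n) (hp25 : 25 * n < p) (N : ℤ) :
    padicNorm p ((N : ℚ) * formPT (aTD1 n) (bTD1 n)) ≤ padicNorm p (N : ℚ) := by
  rw [padicNorm.mul]
  exact mul_le_of_le_one_right (padicNorm.nonneg _) (padicNorm_formPT_le_one_of_gt hn hp25)

end Summit.KontsevichZagierPeriods.Zeta5Search.Denom.TwoTaleD1Slice

end
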